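import Summits.QuantumFields.YangMills.Theorems.BalabanLadderNTCeilingPriceSmeared
import Summits.QuantumFields.YangMills.Theorems.ThermalDescentSeamFromMoments
import HarnessLib

/-!
# Route `SqueezedSkewness`, LINE μ «slab response» (crux `BalabanLadder.NT`, stmt-QuantumFields-19353), support stub
# `stub_mirrorDescent`: the torus-side MODULUS OF CONTINUITY and CEILING of the mirror two-point function

At ONE coupling on ONE odd torus, under the `n`-point collar bound of `MomentBounds` (constant `C`, radius `R`), for test
functions with a time gap `δ` on either side of the reflection plane and supports in a ball of radius `σ` (`2σ ≤ sL`,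
`(R+2)s ≤ δ`):

* `abs_torusCov_le_two` — the `n = 2` collar output: `|Cov_T(dens x, dens y)| ≤ (C/R⁴)²` at torus-separated sites;
* `torusSep_of_gap` — a site charged below time `−δ` and a site charged above time `δ` are `2R+4` torus-separated;
* `abs_Q2_sub_Q2_le` — `|Q2(f₁, g₁) − Q2(f₂, g₂)| ≤ B·(S(f₁−f₂)S(g₁) + S(f₂)S(g₁−g₂))` from a pointwise bound `B` on the
  charged pairs (`S(w) = Σ_{x∈box}|w(s·x)|`, differences taken pointwise);
* `modulus_bound`, `ceiling_bound` — the two combined: the smeared mirror two-point function moves by at most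
  `(C/R⁴)²·(S(f₁−f₂)S(g₁) + S(f₂)S(g₁−g₂))` and is at most `(C/R⁴)²·S(f)S(g)` in absolute value;
* envelopes of a Schwartz function UNIFORM over small shifts: `sum_abs_sub_shift_le`, `sum_abs_sub_shift_theta_le`
  (`Σ_{x∈box}|v(s·x + e) − v(s·x)| ≤ 4⁴K‖e‖/s⁴`), and the support bookkeeping of translated bumps
  (`window_of_closedBall`, `spatial_of_closedBall`, `gap_of_closedBall`, `theta_gap`, `closedBall_subset_closedBall_zero`).

Fleet lead `ym-spine-19353-p1` g23 (`--supports stmt-QuantumFields-19353`).  HONEST FRAMING: finite-torus bookkeeping at one coupling;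
`MomentBounds6` is NOT proved; no NT statement, crux, rung or mass gap follows. [folklore]
-/

set_option autoImplicit false

noncomputable section

open scoped SchwartzMap
open MeasureTheory Filter Topology
open Literature.MathematicalPhysics.QuantumFieldTheory Literature.MathematicalPhysics.QuantumLattice
open Literature.Probability.LatticeModels
open Summit.QuantumFields.YangMills.Cruxes.OSLegsFromFemtoAndGap.DlrCollarTransfer
open Summit.QuantumFields.YangMills.Cruxes.NT.CumulantPolarisation (torusE_centred_centred)
open Summit.QuantumFields.YangMills.Cruxes.NT.Reference (smul_siteToE_apply_zero)

namespace Summit.QuantumFields.YangMills.Theorems.MirrorDescentModulus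

/-! ## §1 One coupling: the `n = 2` collar output -/

section Pointwise

variable (G : Type) [Group G] [TopologicalSpace G] [IsTopologicalGroup G] [CompactSpace G]
  [MeasurableSpace G] [BorelSpace G] (r : LatticeRep G)

/-- **`n = 2`: the centred-moment bound at one coupling caps the torus covariance of the action density at torus-separated
sites**: `|Cov_T(dens x, dens y)| ≤ (C/R⁴)²`. [folklore] -/
theorem abs_torusCov_le_two (β : ℝ) (L : ℕ) {C : ℝ} {R : ℕ}
    (H : ∀ (n : ℕ) (x : Fin n → (Fin 4 → ℤ)),
      (∀ i j : Fin n, i ≠ j → ∃ k : Fin 4,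
        (2 * (R : ℤ) + 4) ≤ |((((x i k - x j k : ℤ) : ZMod (2 * L + 1))).valMinAbs : ℤ)|) →
      |torusE G r β L (fun U => ∏ i, (dens G r (x i) U - torusE G r β L (dens G r (x i))))| ≤ (C / (R : ℝ) ^ 4) ^ n)
    (x y : Fin 4 → ℤ)
    (hsep : ∃ k : Fin 4, (2 * (R : ℤ) + 4) ≤ |((((x k - y k : ℤ) : ZMod (2 * L + 1))).valMinAbs : ℤ)|) :
    |torusE G r β L (fun U => dens G r x U * dens G r y U) - torusE G r β L (dens G r x) * torusE G r β L (dens G r y)| ≤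
      (C / (R : ℝ) ^ 4) ^ 2 := by
  have hsep' : ∀ i j : Fin 2, i ≠ j → ∃ k : Fin 4,
      (2 * (R : ℤ) + 4) ≤ |((((![x, y] i k - ![x, y] j k : ℤ) : ZMod (2 * L + 1))).valMinAbs : ℤ)| := by
    intro i j hij
    fin_cases i <;> fin_cases j
    · exact absurd rfl hij
    · simpa using hsep
    · obtain ⟨k, hk⟩ := hsep
      refine ⟨k, ?_⟩
      rw [Summit.QuantumFields.YangMills.Cruxes.NT.CeilingPrice.abs_valMinAbs_sub_comm L (x k) (y k)] at hk
      simpa using hk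
    · exact absurd rfl hij
  have h := H 2 ![x, y] hsep'
  have hprod : (fun U => ∏ i : Fin 2, (dens G r (![x, y] i) U - torusE G r β L (dens G r (![x, y] i)))) =
      fun U => (dens G r x U - torusE G r β L (dens G r x)) * (dens G r y U - torusE G r β L (dens G r y)) := by
    funext U
    rw [Fin.prod_univ_two]
    simp
  rw [hprod, torusE_centred_centred G r β L (continuous_dens r x) (continuous_dens r y)] at h
  have e : torusE G r β L (fun U => dens G r x U * dens G r y U) -
        torusE G r β L (dens G r y) * torusE G r β L (dens G r x) -
        torusE G r β L (dens G r x) * torusE G r β L (dens G r y) +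
        torusE G r β L (dens G r x) * torusE G r β L (dens G r y) =
      torusE G r β L (fun U => dens G r x U * dens G r y U) -
        torusE G r β L (dens G r x) * torusE G r β L (dens G r y) := by ring
  rwa [e] at h

end Pointwise

/-! ## §2 Geometry: a reflected charge and a direct charge are torus-separated -/

/-- **Torus separation across the reflection plane.**  On the torus of side `2L+1` at spacing `s > 0`: lattice points `x`, `y`
with `s·x₀ ≤ −δ`, `δ ≤ s·y₀`, both time coordinates of size `≤ σ` in physical units, `2σ ≤ sL` (no wrap-around) and
`(R+2)s ≤ δ` are `2R+4` apart in the time coordinate, cyclically. [folklore] -/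
theorem torusSep_of_gap {s δ σ : ℝ} (hs : 0 < s) {L R : ℕ} (hσL : 2 * σ ≤ s * L) (hRδ : ((R : ℝ) + 2) * s ≤ δ)
    {x y : Fin 4 → ℤ} (hx0 : s * (x 0 : ℝ) ≤ -δ) (hy0 : δ ≤ s * (y 0 : ℝ)) (hax : |s * (x 0 : ℝ)| ≤ σ)
    (hay : |s * (y 0 : ℝ)| ≤ σ) :
    ∃ k : Fin 4, (2 * (R : ℤ) + 4) ≤ |((((x k - y k : ℤ) : ZMod (2 * L + 1))).valMinAbs : ℤ)| := by
  refine ⟨0, ?_⟩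
  have habs : |x 0 - y 0| ≤ (L : ℤ) := by
    have h1 : s * |((x 0 - y 0 : ℤ) : ℝ)| ≤ s * L := by
      push_cast
      rw [← abs_of_pos hs, ← abs_mul, mul_sub, abs_of_pos hs]
      calc |s * (x 0 : ℝ) - s * (y 0 : ℝ)| ≤ |s * (x 0 : ℝ)| + |s * (y 0 : ℝ)| := abs_sub _ _
        _ ≤ σ + σ := add_le_add hax hay
        _ ≤ s * L := by linarith
    exact_mod_cast le_of_mul_le_mul_left h1 hs
  rw [Summit.QuantumFields.YangMills.Theorems.OSLegsFromFemtoAndGap.valMinAbs_intCast_of_abs_le habs]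
  have hdiff : ((2 * (R : ℤ) + 4 : ℤ) : ℝ) * s ≤ s * (((y 0 - x 0 : ℤ)) : ℝ) := by
    push_cast
    nlinarith
  have h2 : ((2 * (R : ℤ) + 4 : ℤ) : ℝ) ≤ (((y 0 - x 0 : ℤ)) : ℝ) := by
    rw [mul_comm] at hdiff
    exact le_of_mul_le_mul_left hdiff hs
  have h3 : (2 * (R : ℤ) + 4) ≤ y 0 - x 0 := by exact_mod_cast h2
  rw [abs_sub_comm]
  exact h3.trans (le_abs_self _)

/-- A charged lattice point of a function with a LOWER time gap (`f p ≠ 0 → δ ≤ p₀`) supported in the ball of radius `σ`: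
`δ ≤ s·y₀` and `|s·y₀| ≤ σ`. [folklore] -/
theorem charge_above {f : EuclideanSpace ℝ (Fin 4) → ℝ} {s δ σ : ℝ}
    (hf : ∀ p : EuclideanSpace ℝ (Fin 4), f p ≠ 0 → δ ≤ p 0)
    (hfσ : tsupport f ⊆ Metric.closedBall 0 σ) {y : Fin 4 → ℤ} (hy : f (s • siteToE y) ≠ 0) :
    δ ≤ s * (y 0 : ℝ) ∧ |s * (y 0 : ℝ)| ≤ σ := by
  refine ⟨by simpa [smul_siteToE_apply_zero] using hf _ hy, ?_⟩
  have hmem := hfσ (subset_tsupport _ (Function.mem_support.2 hy))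
  rw [Metric.mem_closedBall, dist_zero_right] at hmem
  have h := PiLp.norm_apply_le (s • siteToE y) 0
  rw [smul_siteToE_apply_zero, Real.norm_eq_abs] at h
  exact h.trans hmem

/-- A charged lattice point of a function with an UPPER time gap (`f p ≠ 0 → p₀ ≤ −δ`) supported in the ball of radius `σ`:
`s·x₀ ≤ −δ` and `|s·x₀| ≤ σ`. [folklore] -/
theorem charge_below {f : EuclideanSpace ℝ (Fin 4) → ℝ} {s δ σ : ℝ}
    (hf : ∀ p : EuclideanSpace ℝ (Fin 4), f p ≠ 0 → p 0 ≤ -δ)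
    (hfσ : tsupport f ⊆ Metric.closedBall 0 σ) {x : Fin 4 → ℤ} (hx : f (s • siteToE x) ≠ 0) :
    s * (x 0 : ℝ) ≤ -δ ∧ |s * (x 0 : ℝ)| ≤ σ := by
  refine ⟨by simpa [smul_siteToE_apply_zero] using hf _ hx, ?_⟩
  have hmem := hfσ (subset_tsupport _ (Function.mem_support.2 hx))
  rw [Metric.mem_closedBall, dist_zero_right] at hmem
  have h := PiLp.norm_apply_le (s • siteToE x) 0
  rw [smul_siteToE_apply_zero, Real.norm_eq_abs] at h
  exact h.trans hmem

/-! ## §3 Smeared sums: differences inherit pointwise bounds on the charged pairs -/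

section Smeared

variable (G : Type) [Group G] [TopologicalSpace G] [IsTopologicalGroup G] [CompactSpace G]
  [MeasurableSpace G] [BorelSpace G] (r : LatticeRep G)

/-- **`|Q2(f₁, g₁) − Q2(f₂, g₂)| ≤ B·(S(f₁−f₂)·S(g₁) + S(f₂)·S(g₁−g₂))`** whenever the torus covariance of the action densities is
bounded by `B` on every pair of lattice points charged by (`f₁` or `f₂`) and (`g₁` or `g₂`); the differences are taken
pointwise, `S(w) = Σ_{x ∈ box L} |w(s x)|` (bilinearity of `Q2`). [folklore] -/
theorem abs_Q2_sub_Q2_le (β : ℝ) (L : ℕ) (s : ℝ) (f₁ f₂ g₁ g₂ : 𝓢(EuclideanSpace ℝ (Fin 4), ℝ)) {B : ℝ}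
    (hB : ∀ x ∈ box 4 L, ∀ y ∈ box 4 L, (f₁ (s • siteToE x) ≠ 0 ∨ f₂ (s • siteToE x) ≠ 0) →
      (g₁ (s • siteToE y) ≠ 0 ∨ g₂ (s • siteToE y) ≠ 0) →
      |torusE G r β L (fun U => dens G r x U * dens G r y U) - torusE G r β L (dens G r x) * torusE G r β L (dens G r y)|
        ≤ B) :
    |Q2 G r β L s f₁ g₁ - Q2 G r β L s f₂ g₂| ≤
      B * ((∑ x ∈ box 4 L, |f₁ (s • siteToE x) - f₂ (s • siteToE x)|) * (∑ y ∈ box 4 L, |g₁ (s • siteToE y)|) +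
        (∑ x ∈ box 4 L, |f₂ (s • siteToE x)|) * (∑ y ∈ box 4 L, |g₁ (s • siteToE y) - g₂ (s • siteToE y)|)) := by
  -- name the covariance kernel
  set K : (Fin 4 → ℤ) → (Fin 4 → ℤ) → ℝ := fun x y =>
    torusE G r β L (fun U => dens G r x U * dens G r y U) - torusE G r β L (dens G r x) * torusE G r β L (dens G r y)
    with hK
  have hQ : ∀ f g : 𝓢(EuclideanSpace ℝ (Fin 4), ℝ),
      Q2 G r β L s f g = ∑ x ∈ box 4 L, ∑ y ∈ box 4 L, f (s • siteToE x) * g (s • siteToE y) * K x y := by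
    intro f g; rfl
  rw [hQ, hQ, ← Finset.sum_sub_distrib]
  simp_rw [← Finset.sum_sub_distrib]
  -- termwise bound
  have hterm : ∀ x ∈ box 4 L, ∀ y ∈ box 4 L,
      |f₁ (s • siteToE x) * g₁ (s • siteToE y) * K x y - f₂ (s • siteToE x) * g₂ (s • siteToE y) * K x y| ≤
        (|f₁ (s • siteToE x) - f₂ (s • siteToE x)| * |g₁ (s • siteToE y)| +
          |f₂ (s • siteToE x)| * |g₁ (s • siteToE y) - g₂ (s • siteToE y)|) * B := by
    intro x hx y hy
    have e : f₁ (s • siteToE x) * g₁ (s • siteToE y) * K x y - f₂ (s • siteToE x) * g₂ (s • siteToE y) * K x y =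
        ((f₁ (s • siteToE x) - f₂ (s • siteToE x)) * g₁ (s • siteToE y) +
          f₂ (s • siteToE x) * (g₁ (s • siteToE y) - g₂ (s • siteToE y))) * K x y := by ring
    rw [e, abs_mul]
    by_cases hc : (f₁ (s • siteToE x) ≠ 0 ∨ f₂ (s • siteToE x) ≠ 0) ∧ (g₁ (s • siteToE y) ≠ 0 ∨ g₂ (s • siteToE y) ≠ 0)
    · have hKB : |K x y| ≤ B := hB x hx y hy hc.1 hc.2
      have hcoef : |(f₁ (s • siteToE x) - f₂ (s • siteToE x)) * g₁ (s • siteToE y) +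
          f₂ (s • siteToE x) * (g₁ (s • siteToE y) - g₂ (s • siteToE y))| ≤
          |f₁ (s • siteToE x) - f₂ (s • siteToE x)| * |g₁ (s • siteToE y)| +
            |f₂ (s • siteToE x)| * |g₁ (s • siteToE y) - g₂ (s • siteToE y)| := by
        refine (abs_add_le _ _).trans ?_
        rw [abs_mul, abs_mul]
      exact mul_le_mul hcoef hKB (abs_nonneg _) (by positivity)
    · -- an uncharged pair: both sides vanish
      rw [not_and_or] at hc
      rcases hc with hc | hc
      · push Not at hc
        simp [hc.1, hc.2]
      · push Not at hc
        simp [hc.1, hc.2]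
  calc |∑ x ∈ box 4 L, ∑ y ∈ box 4 L,
          (f₁ (s • siteToE x) * g₁ (s • siteToE y) * K x y - f₂ (s • siteToE x) * g₂ (s • siteToE y) * K x y)|
      ≤ ∑ x ∈ box 4 L, ∑ y ∈ box 4 L,
          (|f₁ (s • siteToE x) - f₂ (s • siteToE x)| * |g₁ (s • siteToE y)| +
            |f₂ (s • siteToE x)| * |g₁ (s • siteToE y) - g₂ (s • siteToE y)|) * B := by
        refine (Finset.abs_sum_le_sum_abs _ _).trans (Finset.sum_le_sum fun x hx => ?_)
        exact (Finset.abs_sum_le_sum_abs _ _).trans (Finset.sum_le_sum fun y hy => hterm x hx y hy)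
    _ = (∑ x ∈ box 4 L, ∑ y ∈ box 4 L,
          (|f₁ (s • siteToE x) - f₂ (s • siteToE x)| * |g₁ (s • siteToE y)| +
            |f₂ (s • siteToE x)| * |g₁ (s • siteToE y) - g₂ (s • siteToE y)|)) * B := by
        rw [Finset.sum_mul]
        exact Finset.sum_congr rfl fun x _ => by rw [Finset.sum_mul]
    _ = B * ((∑ x ∈ box 4 L, |f₁ (s • siteToE x) - f₂ (s • siteToE x)|) * (∑ y ∈ box 4 L, |g₁ (s • siteToE y)|) +
        (∑ x ∈ box 4 L, |f₂ (s • siteToE x)|) * (∑ y ∈ box 4 L, |g₁ (s • siteToE y) - g₂ (s • siteToE y)|)) := by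
        rw [mul_comm, Finset.sum_mul_sum, Finset.sum_mul_sum, ← Finset.sum_add_distrib]
        congr 1
        exact Finset.sum_congr rfl fun x _ => by rw [← Finset.sum_add_distrib]

/-! ## §4 The modulus of continuity and the ceiling of the mirror two-point function at one coupling -/

/-- **Modulus of continuity of the mirror two-point function at one coupling.**  Under the `n`-point collar bound at
`(β, L, R)` with constant `C`: if `f₁, f₂` are charged only below time `−δ` and `g₁, g₂` only above time `δ`, all four
supported in the ball of radius `σ`, `2σ ≤ sL`, `(R+2)s ≤ δ`, then
`|Q2(f₁, g₁) − Q2(f₂, g₂)| ≤ (C/R⁴)²·(S(f₁−f₂)·S(g₁) + S(f₂)·S(g₁−g₂))`. [folklore] -/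
theorem modulus_bound (β : ℝ) (L : ℕ) {C : ℝ} {R : ℕ}
    (H : ∀ (n : ℕ) (x : Fin n → (Fin 4 → ℤ)),
      (∀ i j : Fin n, i ≠ j → ∃ k : Fin 4,
        (2 * (R : ℤ) + 4) ≤ |((((x i k - x j k : ℤ) : ZMod (2 * L + 1))).valMinAbs : ℤ)|) →
      |torusE G r β L (fun U => ∏ i, (dens G r (x i) U - torusE G r β L (dens G r (x i))))| ≤ (C / (R : ℝ) ^ 4) ^ n)
    {s δ σ : ℝ} (hs : 0 < s) (hσL : 2 * σ ≤ s * L) (hRδ : ((R : ℝ) + 2) * s ≤ δ)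
    (f₁ f₂ g₁ g₂ : 𝓢(EuclideanSpace ℝ (Fin 4), ℝ))
    (hf₁ : ∀ p : EuclideanSpace ℝ (Fin 4), f₁ p ≠ 0 → p 0 ≤ -δ) (hf₂ : ∀ p : EuclideanSpace ℝ (Fin 4), f₂ p ≠ 0 → p 0 ≤ -δ)
    (hg₁ : ∀ p : EuclideanSpace ℝ (Fin 4), g₁ p ≠ 0 → δ ≤ p 0) (hg₂ : ∀ p : EuclideanSpace ℝ (Fin 4), g₂ p ≠ 0 → δ ≤ p 0)
    (hf₁σ : tsupport (f₁ : EuclideanSpace ℝ (Fin 4) → ℝ) ⊆ Metric.closedBall 0 σ)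
    (hf₂σ : tsupport (f₂ : EuclideanSpace ℝ (Fin 4) → ℝ) ⊆ Metric.closedBall 0 σ)
    (hg₁σ : tsupport (g₁ : EuclideanSpace ℝ (Fin 4) → ℝ) ⊆ Metric.closedBall 0 σ)
    (hg₂σ : tsupport (g₂ : EuclideanSpace ℝ (Fin 4) → ℝ) ⊆ Metric.closedBall 0 σ) :
    |Q2 G r β L s f₁ g₁ - Q2 G r β L s f₂ g₂| ≤
      (C / (R : ℝ) ^ 4) ^ 2 *
        ((∑ x ∈ box 4 L, |f₁ (s • siteToE x) - f₂ (s • siteToE x)|) * (∑ y ∈ box 4 L, |g₁ (s • siteToE y)|) +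
          (∑ x ∈ box 4 L, |f₂ (s • siteToE x)|) * (∑ y ∈ box 4 L, |g₁ (s • siteToE y) - g₂ (s • siteToE y)|)) := by
  refine abs_Q2_sub_Q2_le G r β L s f₁ f₂ g₁ g₂ fun x _ y _ hx hy => ?_
  have hxd : s * (x 0 : ℝ) ≤ -δ ∧ |s * (x 0 : ℝ)| ≤ σ := by
    rcases hx with hx | hx
    · exact charge_below hf₁ hf₁σ hx
    · exact charge_below hf₂ hf₂σ hx
  have hyd : δ ≤ s * (y 0 : ℝ) ∧ |s * (y 0 : ℝ)| ≤ σ := by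
    rcases hy with hy | hy
    · exact charge_above hg₁ hg₁σ hy
    · exact charge_above hg₂ hg₂σ hy
  exact abs_torusCov_le_two G r β L H x y (torusSep_of_gap hs hσL hRδ hxd.1 hyd.1 hxd.2 hyd.2)

/-- **Ceiling of the mirror two-point function at one coupling.**  Under the `n`-point collar bound at `(β, L, R)` with
constant `C`: if `f` is charged only below time `−δ` and `g` only above time `δ`, both supported in the ball of radius `σ`,
`2σ ≤ sL`, `(R+2)s ≤ δ`, then `|Q2(f, g)| ≤ S(f)·S(g)·(C/R⁴)²`. [folklore] -/
theorem ceiling_bound (β : ℝ) (L : ℕ) {C : ℝ} {R : ℕ}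
    (H : ∀ (n : ℕ) (x : Fin n → (Fin 4 → ℤ)),
      (∀ i j : Fin n, i ≠ j → ∃ k : Fin 4,
        (2 * (R : ℤ) + 4) ≤ |((((x i k - x j k : ℤ) : ZMod (2 * L + 1))).valMinAbs : ℤ)|) →
      |torusE G r β L (fun U => ∏ i, (dens G r (x i) U - torusE G r β L (dens G r (x i))))| ≤ (C / (R : ℝ) ^ 4) ^ n)
    {s δ σ : ℝ} (hs : 0 < s) (hσL : 2 * σ ≤ s * L) (hRδ : ((R : ℝ) + 2) * s ≤ δ)
    (f g : 𝓢(EuclideanSpace ℝ (Fin 4), ℝ))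
    (hf : ∀ p : EuclideanSpace ℝ (Fin 4), f p ≠ 0 → p 0 ≤ -δ) (hg : ∀ p : EuclideanSpace ℝ (Fin 4), g p ≠ 0 → δ ≤ p 0)
    (hfσ : tsupport (f : EuclideanSpace ℝ (Fin 4) → ℝ) ⊆ Metric.closedBall 0 σ)
    (hgσ : tsupport (g : EuclideanSpace ℝ (Fin 4) → ℝ) ⊆ Metric.closedBall 0 σ) :
    |Q2 G r β L s f g| ≤
      (∑ x ∈ box 4 L, |f (s • siteToE x)|) * (∑ y ∈ box 4 L, |g (s • siteToE y)|) * (C / (R : ℝ) ^ 4) ^ 2 := by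
  refine Summit.QuantumFields.YangMills.Cruxes.NT.CeilingPrice.abs_Q2_le_of_pointwise G r β L s f g fun x _ y _ hx hy => ?_
  obtain ⟨hx0, hxσ⟩ := charge_below hf hfσ hx
  obtain ⟨hy0, hyσ⟩ := charge_above hg hgσ hy
  exact abs_torusCov_le_two G r β L H x y (torusSep_of_gap hs hσL hRδ hx0 hy0 hxσ hyσ)

end Smeared

/-! ## §5 Envelopes uniform over small shifts, and the support bookkeeping of translated bumps -/

/-- **Shift envelope**: `Σ_{x ∈ box L} |v(s·x + e) − v(s·x)| ≤ 4⁴·K·‖e‖/s⁴` for `‖e‖ ≤ 1`, `0 < s ≤ 1`, with the constant `K` of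
`exists_abs_sub_le_decay` (mean value + Schwartz decay, then the uniform lattice Riemann bound). [folklore] -/
theorem sum_abs_sub_shift_le {v : 𝓢(EuclideanSpace ℝ (Fin 4), ℝ)} {K : ℝ}
    (hK : ∀ (z e : EuclideanSpace ℝ (Fin 4)), ‖e‖ ≤ 1 → |v (z + e) - v z| ≤ K * ‖e‖ * ((1 + ‖z‖) ^ 8)⁻¹)
    (L : ℕ) {s : ℝ} (hs : 0 < s) (hs1 : s ≤ 1) {e : EuclideanSpace ℝ (Fin 4)} (he : ‖e‖ ≤ 1) :
    ∑ x ∈ box 4 L, |v (s • siteToE x + e) - v (s • siteToE x)| ≤ 4 ^ 4 * K * ‖e‖ / s ^ 4 := by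
  have hK0 : 0 ≤ K * ‖e‖ := by
    have h := hK 0 e he
    have h8 : ((1 + ‖(0 : EuclideanSpace ℝ (Fin 4))‖) ^ 8)⁻¹ = 1 := by simp
    rw [h8, mul_one] at h
    exact (abs_nonneg _).trans h
  have hRB := Summit.QuantumFields.YangMills.Cruxes.UniversalDetectorLimitExtraction.latticeRiemannBound 4 L hs hs1
  have hs4 : 0 < s ^ 4 := by positivity
  have hsum : ∑ x ∈ box 4 L, ((1 + ‖s • siteToE x‖) ^ (2 * 4))⁻¹ ≤ 4 ^ 4 / s ^ 4 := by
    rw [le_div_iff₀ hs4, mul_comm]; exact hRB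
  calc ∑ x ∈ box 4 L, |v (s • siteToE x + e) - v (s • siteToE x)|
      ≤ ∑ x ∈ box 4 L, K * ‖e‖ * ((1 + ‖s • siteToE x‖) ^ (2 * 4))⁻¹ :=
        Finset.sum_le_sum fun x _ => by simpa using hK (s • siteToE x) e he
    _ = K * ‖e‖ * ∑ x ∈ box 4 L, ((1 + ‖s • siteToE x‖) ^ (2 * 4))⁻¹ := by rw [Finset.mul_sum]
    _ ≤ K * ‖e‖ * (4 ^ 4 / s ^ 4) := mul_le_mul_of_nonneg_left hsum hK0
    _ = 4 ^ 4 * K * ‖e‖ / s ^ 4 := by ring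

/-- **Shift envelope through the time reflection**: `Σ_{x ∈ box L} |v(θ(s·x) + e) − v(θ(s·x))| ≤ 4⁴·K·‖e‖/s⁴` (the reflection
is an isometry, so the Japanese bracket is unchanged). [folklore] -/
theorem sum_abs_sub_shift_theta_le {v : 𝓢(EuclideanSpace ℝ (Fin 4), ℝ)} {K : ℝ}
    (hK : ∀ (z e : EuclideanSpace ℝ (Fin 4)), ‖e‖ ≤ 1 → |v (z + e) - v z| ≤ K * ‖e‖ * ((1 + ‖z‖) ^ 8)⁻¹)
    (L : ℕ) {s : ℝ} (hs : 0 < s) (hs1 : s ≤ 1) {e : EuclideanSpace ℝ (Fin 4)} (he : ‖e‖ ≤ 1) :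
    ∑ x ∈ box 4 L, |v (timeReflection 4 (s • siteToE x) + e) - v (timeReflection 4 (s • siteToE x))| ≤
      4 ^ 4 * K * ‖e‖ / s ^ 4 := by
  have hK0 : 0 ≤ K * ‖e‖ := by
    have h := hK 0 e he
    have h8 : ((1 + ‖(0 : EuclideanSpace ℝ (Fin 4))‖) ^ 8)⁻¹ = 1 := by simp
    rw [h8, mul_one] at h
    exact (abs_nonneg _).trans h
  have hRB := Summit.QuantumFields.YangMills.Cruxes.UniversalDetectorLimitExtraction.latticeRiemannBound 4 L hs hs1
  have hs4 : 0 < s ^ 4 := by positivity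
  have hsum : ∑ x ∈ box 4 L, ((1 + ‖s • siteToE x‖) ^ (2 * 4))⁻¹ ≤ 4 ^ 4 / s ^ 4 := by
    rw [le_div_iff₀ hs4, mul_comm]; exact hRB
  calc ∑ x ∈ box 4 L, |v (timeReflection 4 (s • siteToE x) + e) - v (timeReflection 4 (s • siteToE x))|
      ≤ ∑ x ∈ box 4 L, K * ‖e‖ * ((1 + ‖s • siteToE x‖) ^ (2 * 4))⁻¹ :=
        Finset.sum_le_sum fun x _ => by
          have h := hK (timeReflection 4 (s • siteToE x)) e he
          rw [LinearIsometryEquiv.norm_map] at h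
          simpa using h
    _ = K * ‖e‖ * ∑ x ∈ box 4 L, ((1 + ‖s • siteToE x‖) ^ (2 * 4))⁻¹ := by rw [Finset.mul_sum]
    _ ≤ K * ‖e‖ * (4 ^ 4 / s ^ 4) := mul_le_mul_of_nonneg_left hsum hK0
    _ = 4 ^ 4 * K * ‖e‖ / s ^ 4 := by ring

/-- Coordinates are controlled by the distance: `|y j − c j| ≤ dist y c`. [folklore] -/
theorem abs_sub_apply_le_dist (y c : EuclideanSpace ℝ (Fin 4)) (j : Fin 4) : |y j - c j| ≤ dist y c := by
  have h := PiLp.norm_apply_le (y - c) j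
  rw [PiLp.sub_apply, Real.norm_eq_abs] at h
  rwa [dist_eq_norm]

/-- **Window of a bump**: a function supported in `closedBall(c, ρ)` with `δ₁ < c₀ − ρ` and `c₀ + ρ < δ₂` is supported in the
time window `δ₁ < y₀ < δ₂`. [folklore] -/
theorem window_of_closedBall {f : EuclideanSpace ℝ (Fin 4) → ℝ} {c : EuclideanSpace ℝ (Fin 4)} {ρ δ₁ δ₂ : ℝ}
    (hf : tsupport f ⊆ Metric.closedBall c ρ) (h1 : δ₁ < c 0 - ρ) (h2 : c 0 + ρ < δ₂) :
    tsupport f ⊆ {y : EuclideanSpace ℝ (Fin 4) | δ₁ < y 0 ∧ y 0 < δ₂} := by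
  intro y hy
  have hd : dist y c ≤ ρ := Metric.mem_closedBall.1 (hf hy)
  have h := (abs_sub_apply_le_dist y c 0).trans hd
  rw [abs_le] at h
  simp only [Set.mem_setOf_eq]
  constructor <;> linarith [h.1, h.2]

/-- **Time gap of a bump**: a function supported in `closedBall(c, ρ)` is charged only at times `≥ c₀ − ρ`. [folklore] -/
theorem gap_of_closedBall {f : EuclideanSpace ℝ (Fin 4) → ℝ} {c : EuclideanSpace ℝ (Fin 4)} {ρ : ℝ}
    (hf : tsupport f ⊆ Metric.closedBall c ρ) (p : EuclideanSpace ℝ (Fin 4)) (hp : f p ≠ 0) : c 0 - ρ ≤ p 0 := by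
  have hd : dist p c ≤ ρ := Metric.mem_closedBall.1 (hf (subset_tsupport _ (Function.mem_support.2 hp)))
  have h := (abs_sub_apply_le_dist p c 0).trans hd
  rw [abs_le] at h
  linarith [h.1]

/-- **Time gap of a reflected bump**: if `f` is charged only at times `≥ δ`, then `θf` is charged only at times `≤ −δ`.
[folklore] -/
theorem theta_gap {f : 𝓢(EuclideanSpace ℝ (Fin 4), ℝ)} {δ : ℝ}
    (hf : ∀ p : EuclideanSpace ℝ (Fin 4), f p ≠ 0 → δ ≤ p 0) (p : EuclideanSpace ℝ (Fin 4))
    (hp : thetaTest 4 f p ≠ 0) : p 0 ≤ -δ := by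
  rw [thetaTest_apply] at hp
  have h := hf _ hp
  have h0 : (timeReflection 4 p) 0 = -(p 0) := by simp
  rw [h0] at h
  linarith

/-- **Spatial extent of a bump on the time axis**: a function supported in `closedBall(c, ρ)` with `c` on the time axis
(`c (succ i) = 0`) and `ρ < s(L + ½)` is supported in the open spatial torus `|y_i| < s(L + ½)`. [folklore] -/
theorem spatial_of_closedBall {f : EuclideanSpace ℝ (Fin 4) → ℝ} {c : EuclideanSpace ℝ (Fin 4)} {ρ s : ℝ} {L : ℕ}
    (hf : tsupport f ⊆ Metric.closedBall c ρ) (hc : ∀ i : Fin 3, c i.succ = 0) (hρ : ρ < s * (L + 1 / 2)) :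
    tsupport f ⊆ {y : EuclideanSpace ℝ (Fin 4) | ∀ i : Fin 3, |y i.succ| < s * (L + 1 / 2)} := by
  intro y hy
  have hd : dist y c ≤ ρ := Metric.mem_closedBall.1 (hf hy)
  simp only [Set.mem_setOf_eq]
  intro i
  have h := (abs_sub_apply_le_dist y c i.succ).trans hd
  rw [hc i, sub_zero] at h
  exact lt_of_le_of_lt h hρ

/-- A closed ball around a point `c` with `‖c‖ ≤ 2` of radius `ρ ≤ 1` lies in the closed ball of radius `3` around the origin.
[folklore] -/
theorem closedBall_subset_closedBall_zero_three {c : EuclideanSpace ℝ (Fin 4)} {ρ : ℝ} (hc : ‖c‖ ≤ 2) (hρ : ρ ≤ 1) :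
    Metric.closedBall c ρ ⊆ Metric.closedBall (0 : EuclideanSpace ℝ (Fin 4)) 3 := by
  intro y hy
  rw [Metric.mem_closedBall, dist_eq_norm] at hy
  rw [mem_closedBall_zero_iff]
  calc ‖y‖ = ‖(y - c) + c‖ := by rw [sub_add_cancel]
    _ ≤ ‖y - c‖ + ‖c‖ := norm_add_le _ _
    _ ≤ 3 := by linarith

/-- **Support of a translate**: `tsupport v ⊆ closedBall(c, ρ)` ⇒ `tsupport v(· − w) ⊆ closedBall(c + w, ρ)`. [folklore] -/
theorem tsupport_compSubConst_subset_closedBall {v : 𝓢(EuclideanSpace ℝ (Fin 4), ℝ)}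
    {c : EuclideanSpace ℝ (Fin 4)} {ρ : ℝ}
    (hv : tsupport (v : EuclideanSpace ℝ (Fin 4) → ℝ) ⊆ Metric.closedBall c ρ) (w : EuclideanSpace ℝ (Fin 4)) :
    tsupport ((SchwartzMap.compSubConstCLM ℝ w v : 𝓢(EuclideanSpace ℝ (Fin 4), ℝ)) :
        EuclideanSpace ℝ (Fin 4) → ℝ) ⊆ Metric.closedBall (c + w) ρ := by
  refine closure_minimal (fun z hz => ?_) Metric.isClosed_closedBall
  have hz' : v (z - w) ≠ 0 := by
    rwa [Function.mem_support, SchwartzMap.compSubConstCLM_apply] at hz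
  have h2 := hv (subset_tsupport _ (Function.mem_support.2 hz'))
  rw [Metric.mem_closedBall] at h2 ⊢
  rw [dist_eq_norm] at h2 ⊢
  have : z - (c + w) = (z - w) - c := by abel
  rw [this]
  exact h2

end Summit.QuantumFields.YangMills.Theorems.MirrorDescentModulus

end
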